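import Summits.CriticalPhenomena.PercolationContinuityZ3.Theorems.Transplant.BccSlabProfiles
import HarnessLib

/-!
# Lifting a planar leg to the bcc (001)-slab with PRESCRIBED END VERTICES: every simple lattice path `π` with at least two columns and every pair of
# slab vertices `v`, `w` over its end columns are joined by a self-avoiding slab path whose columns are columns of `π` (`k ≥ 1`)

builds on p205010 (kernel theorem, internal audit signed; external expert review pending) — NOT used in this file.  Lane `prim-bschramm`, seat
`prim-bschramm-p2` (gen 45; class C1b; memo `HOME/bschramm/P2-LATTICES.md` §155 (4), design note `HOME/prim-bschramm-p2-g45/TEMPLATE-DESIGN.md`); helper file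
(`--supports stmt-CriticalPhenomena-4575 --as helper`).
* §1 parity along a lattice walk (`even_sum_iff_of_chain`): the column parity alternates, so the height difference of the end vertices has the parity of the
  planar length;
* §2 the elevator prefix `elev p q m = [p, q, p, q, …]` (`2m` entries) and the chain / column facts of `elev p q m ++ π`;
* §3 **`BccSlab.exists_lift`**: the lift (bounce profile when `|Δh| ≤ ℓ`, elevator + monotone profile when `|Δh| > ℓ`).
This is the leg-lifting step of the routing template for `(BccSlab.sqShadow k).LocalLinkage` (the planar oracle supplies `π`).
[cite: DuminilCopinSidoraviciusTassion2016, §2.3 (proof of Fact 2: the three disjoint paths)] [cite: ConwaySloane1999, Ch. 4 §7.1]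
-/

noncomputable section

namespace Summit.CriticalPhenomena.PercolationContinuityZ3.Theorems.Transplant

namespace BccSlab

open Literature.Probability.Percolation Literature.Probability.LatticeModels SimpleGraph
open scoped Classical

variable {k : ℕ}

/-! ## §1 Parity along a lattice walk -/

/-- **Along a lattice walk the column parity alternates**: `(π_last)₀ + (π_last)₁ − ((π₀)₀ + (π₀)₁) ≡ length − 1 (mod 2)`. [folklore] -/
theorem even_sum_sub_of_chain : ∀ (π : List (Site 2)) (hπ : π ≠ []), π.IsChain (fun a b => (zdGraph 2).Adj a b) →
    Even ((π.getLast hπ) 0 + (π.getLast hπ) 1 - ((π.head hπ) 0 + (π.head hπ) 1) - (π.length - 1 : ℕ))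
  | [], hπ, _ => absurd rfl hπ
  | [p], _, _ => by simp
  | p :: q :: rest, _, hc => by
    have hc' : (q :: rest).IsChain (fun a b => (zdGraph 2).Adj a b) := (List.isChain_cons_cons.1 hc).2
    have ih := even_sum_sub_of_chain (q :: rest) (List.cons_ne_nil _ _) hc'
    have hpq := sum_step_of_adj (List.isChain_cons_cons.1 hc).1
    rw [List.getLast_cons (List.cons_ne_nil _ _)]
    simp only [List.head_cons, List.length_cons, Nat.add_sub_cancel] at ih ⊢
    obtain ⟨m, hm⟩ := ih
    push_cast at hm ⊢
    rcases hpq with e | e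
    · exact ⟨m, by rw [e] at hm; omega⟩
    · exact ⟨m - 1, by rw [e] at hm; omega⟩

/-! ## §2 The elevator prefix -/

/-- `[p, q, p, q, …]` with `2m` entries. [folklore] -/
def elev (p q : Site 2) : ℕ → List (Site 2)
  | 0 => []
  | m + 1 => p :: q :: elev p q m

/-- Its length. [folklore] -/
@[simp] theorem length_elev (p q : Site 2) (m : ℕ) : (elev p q m).length = 2 * m := by
  induction m with
  | zero => rfl
  | succ m ih => simp only [elev, List.length_cons, ih]; ring

/-- Its entries are `p` or `q`. [folklore] -/
theorem mem_elev {p q : Site 2} {m : ℕ} {x : Site 2} (hx : x ∈ elev p q m) : x = p ∨ x = q := by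
  induction m with
  | zero => simp [elev] at hx
  | succ m ih =>
    simp only [elev, List.mem_cons] at hx
    rcases hx with h | h | h
    · exact Or.inl h
    · exact Or.inr h
    · exact ih h

/-- The padded walk starts with `p` (as a cons). [folklore] -/
theorem elev_append_eq_cons {p q : Site 2} {π : List (Site 2)} (hπ : π ≠ []) (hhead : π.head hπ = p) :
    ∀ m : ℕ, ∃ xs : List (Site 2), elev p q m ++ π = p :: xs
  | 0 => by
    obtain ⟨x, xs, hx⟩ := List.exists_cons_of_ne_nil hπ
    subst hx
    simp only [List.head_cons] at hhead
    subst hhead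
    exact ⟨xs, rfl⟩
  | m + 1 => ⟨q :: (elev p q m ++ π), rfl⟩

/-- **The padded walk `elev p q m ++ π` is a lattice walk** when `π` is one starting at `p` and `p ∼ q`. [folklore] -/
theorem isChain_elev_append {p q : Site 2} (hpq : (zdGraph 2).Adj p q) {π : List (Site 2)} (hπ : π ≠ []) (hhead : π.head hπ = p)
    (hc : π.IsChain (fun a b => (zdGraph 2).Adj a b)) : ∀ m : ℕ, (elev p q m ++ π).IsChain (fun a b => (zdGraph 2).Adj a b)
  | 0 => by simpa [elev] using hc
  | m + 1 => by
    obtain ⟨xs, hxs⟩ := elev_append_eq_cons (q := q) hπ hhead m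
    have ih := isChain_elev_append hpq hπ hhead hc m
    rw [hxs] at ih
    show ((p :: q :: (elev p q m ++ π)) : List (Site 2)).IsChain (fun a b => (zdGraph 2).Adj a b)
    rw [hxs]
    exact List.isChain_cons_cons.2 ⟨hpq, List.isChain_cons_cons.2 ⟨hpq.symm, ih⟩⟩

/-- The padded walk starts with `p`. [folklore] -/
theorem head_elev_append {p q : Site 2} {π : List (Site 2)} (hπ : π ≠ []) (hhead : π.head hπ = p) (m : ℕ) (hne : elev p q m ++ π ≠ []) :
    (elev p q m ++ π).head hne = p := by
  cases m with
  | zero => simpa [elev] using hhead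
  | succ m => rfl

/-- The padded walk ends where `π` ends. [folklore] -/
theorem getLast_elev_append {p q : Site 2} {π : List (Site 2)} (hπ : π ≠ []) (m : ℕ) (hne : elev p q m ++ π ≠ []) :
    (elev p q m ++ π).getLast hne = π.getLast hπ := by
  rw [List.getLast_append_of_ne_nil _ hπ]

/-! ## §3 The lift with prescribed end vertices -/

/-- **THE LEG LIFTING LEMMA.**  `k ≥ 1`; `π` a simple lattice path with at least two columns; `v`, `w` slab vertices over its first and last column.  Then a
self-avoiding slab path from `v` to `w` exists all of whose columns are columns of `π`: when the height difference is at most the planar length, follow `π`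
with the bounce profile; otherwise climb first with the elevator between the first two columns (strictly monotone heights) and then follow `π` monotonically.
[cite: DuminilCopinSidoraviciusTassion2016, §2.3 (proof of Fact 2)] -/
theorem exists_lift (hk : 1 ≤ k) {π : List (Site 2)} (hπ : π ≠ []) (hc : π.IsChain (fun a b => (zdGraph 2).Adj a b)) (hnd : π.Nodup)
    (hlen : 2 ≤ π.length) (v w : bslab k) (hv : sh v = π.head hπ) (hw : sh w = π.getLast hπ) :
    ∃ L : List (bslab k), GPath (slabGraph k) L v w ∧ ∀ x ∈ L, sh x ∈ π := by
  have hk' : (1 : ℤ) ≤ k := by exact_mod_cast hk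
  obtain ⟨hv0, hvk, hvpar⟩ := adm_sh_ht v
  obtain ⟨hw0, hwk, hwpar⟩ := adm_sh_ht w
  rw [hv] at hvpar; rw [hw] at hwpar
  have hpar := even_sum_sub_of_chain π hπ hc
  set ℓ : ℕ := π.length - 1 with hℓ
  have hℓ1 : 1 ≤ ℓ := by omega
  have hevn : Even ((ℓ : ℤ) - |ht v - ht w|) := by
    obtain ⟨m, hm⟩ := hpar
    obtain ⟨a, ha⟩ := hvpar
    obtain ⟨b, hb⟩ := hwpar
    rcases abs_choice (ht v - ht w) with e | e
    · exact ⟨((π.getLast hπ) 0 + (π.getLast hπ) 1) - ((π.head hπ) 0 + (π.head hπ) 1) - m + a - b, by rw [e]; omega⟩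
    · exact ⟨-m - a + b, by rw [e]; omega⟩
  by_cases hle : |ht v - ht w| ≤ ℓ
  · -- bounce along `π`
    set hs := bounceProf k (ht v) (ht w) ℓ with hhs
    have hP : Profile k π hs := by
      refine profile_of_walk (by rw [hhs, length_bounceProf]; omega) hc (fun i hi => step_bounceProf k _ _ _ i hi)
        (fun i hi => range_bounceProf hk _ _ _ ⟨hv0, hvk⟩ ⟨hw0, hwk⟩ i hi) fun h1 h2 => ?_
      rw [getElem_zero_bounceProf, ← List.head_eq_getElem hπ]
      exact hvpar
    refine ⟨liftZip k π hs, ?_, fun x hx => sh_mem_of_mem_liftZip hP hx⟩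
    have hG := gpath_liftZip hπ (bounceProf_ne_nil k _ _ _) hc hP (Or.inl hnd)
    rw [head_bounceProf, ← hv, vtx_sh_ht, getLast_bounceProf k (ht v) (ht w) ℓ hle hevn, ← hw, vtx_sh_ht] at hG
    exact hG
  · -- elevator first: `|Δh| = ℓ + 2 m'`
    rw [not_le] at hle
    obtain ⟨p, rest, hpr⟩ := List.exists_cons_of_ne_nil hπ
    obtain ⟨q, rest', hqr⟩ : ∃ q rest', rest = q :: rest' := by
      cases rest with
      | nil => subst hpr; simp at hlen
      | cons q rest' => exact ⟨q, rest', rfl⟩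
    subst hqr
    have hpq : (zdGraph 2).Adj p q := by subst hpr; exact (List.isChain_cons_cons.1 hc).1
    have hheadp : π.head hπ = p := by subst hpr; rfl
    -- the padding amount
    obtain ⟨m', hm'⟩ : ∃ m' : ℕ, |ht v - ht w| = ℓ + 2 * (m' : ℤ) := by
      obtain ⟨c, hc2⟩ := hevn
      refine ⟨(-c).toNat, ?_⟩
      have hc0 : 0 ≤ -c := by omega
      rw [Int.toNat_of_nonneg hc0]; omega
    set π' := elev p q m' ++ π with hπ'
    have hπ'ne : π' ≠ [] := by simp [hπ', hπ]
    have hc' : π'.IsChain (fun a b => (zdGraph 2).Adj a b) := isChain_elev_append hpq hπ hheadp hc m'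
    have hlen' : π'.length = ℓ + 2 * m' + 1 := by rw [hπ', List.length_append, length_elev]; omega
    set n := ℓ + 2 * m' with hn
    set hs := bounceProf k (ht v) (ht w) n with hhs
    have habs : |ht v - ht w| = n := by rw [hn]; push_cast; exact hm'
    have hP : Profile k π' hs := by
      refine profile_of_walk (by rw [hhs, length_bounceProf, hlen']) hc' (fun i hi => step_bounceProf k _ _ _ i hi)
        (fun i hi => range_bounceProf hk _ _ _ ⟨hv0, hvk⟩ ⟨hw0, hwk⟩ i hi) fun h1 h2 => ?_
      rw [getElem_zero_bounceProf, ← List.head_eq_getElem hπ'ne, head_elev_append hπ hheadp m' hπ'ne, ← hheadp]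
      exact hvpar
    refine ⟨liftZip k π' hs, ?_, fun x hx => ?_⟩
    · have hG := gpath_liftZip hπ'ne (bounceProf_ne_nil k _ _ _) hc' hP (Or.inr (nodup_bounceProf_mono k habs))
      rw [head_bounceProf, head_elev_append hπ hheadp m' hπ'ne, ← hheadp, ← hv, vtx_sh_ht,
        getLast_bounceProf k (ht v) (ht w) n habs.le (by rw [habs, sub_self]; exact ⟨0, rfl⟩),
        getLast_elev_append hπ m' hπ'ne, ← hw, vtx_sh_ht] at hG
      exact hG
    · have := sh_mem_of_mem_liftZip hP hx
      rcases List.mem_append.1 this with h | h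
      · rcases mem_elev h with rfl | rfl
        · rw [hpr]; exact List.mem_cons_self
        · rw [hpr]; exact List.mem_cons_of_mem _ List.mem_cons_self
      · exact h

end BccSlab

end Summit.CriticalPhenomena.PercolationContinuityZ3.Theorems.Transplant

end
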